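import Mathlib
import HarnessLib
import Literature.Analysis.PDE.DivFormStrongMaximumPrinciple
import Literature.Analysis.FunctionSpaces.MoserIteration
import Summits.NavierStokesRegularity.NavierStokesRegularity.Theorems.PoloidalWindowDoorPoloidalWindowRigidityDivFormMoserStep
import Summits.NavierStokesRegularity.NavierStokesRegularity.Theorems.PoloidalWindowDoorPoloidalWindowRigidityDivFormLocalReverseHolder

/-!
# Route `PoloidalWindowDoor`, crux K2 (stmt-NavierStokesRegularity-19708) — LOCAL Moser iteration for `div(a∇w) = 0`
# on an open set `U`: reverse Hölder step and the sup/inf chain between two balls (towards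
# `divFormStrongMaximumPrinciple_holds`, GT 8.19, via an interior Harnack inequality)

Local twin of `…DivFormMoserStep.moser_step` / `…DivFormMoserChain.moser_chain_sup` (seat ns-poloidal-K2-p3), `n ≥ 3`,
`κ = n/(n−2)`: the weak equation is assumed only against test functions with `tsupport η ⊆ U` (hypothesis of
`Literature.Analysis.PDE.divFormStrongMaximumPrinciple`), and the balls carry `B̄(x₀,ρ) ⊆ U`; in exchange the chain is
stated between two ARBITRARY concentric balls `B̄(x₀,r') ⊂ B̄(x₀,r)` with the constant `(K/(r−r')²)^{κ/(p₀(κ−1))}` —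
the `(r−r')^{−n/p₀}` blow-up is what the Bombieri–Giusti lemma of the sequel consumes in place of the John–Nirenberg
crossover (which does not localise).

* `moser_step_local` — `‖w^σ‖_{L^{pκ}(B̄(x₀,ρ'))} ≤ (C_S²·2((q/(q−1))²nΛ+λ)/λ·(C₀/(ρ−ρ'))²)^{1/p} ‖w^σ‖_{L^p(B̄(x₀,ρ))}`;
* `moser_chain_local` — `‖w^σ‖_{L^∞(B̄(x₀,r'))} ≤ (K/(r−r')²)^{κ/(p₀(κ−1))} 4^{κ/(p₀(κ−1)²)} ‖w^σ‖_{L^{p₀}(B̄(x₀,r))}`.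

Proofs copied from the siblings with the hypothesis localised and the radii `R(1+2^{−k})` replaced by
`r' + (r−r')2^{−k}`; `eLpNorm_rpow_eq`, `lintegral_enorm_fderiv_sq`, `contDiff_rpow_of_one_le` and the abstract iteration
lemma `Literature.Analysis.FunctionSpaces.eLpNorm_top_le_of_moser_chain` are imported.  Seat ns-in-ser-b g5 (cell
pub/ns-inputs), `ledger fact claim` #1 on `Literature.Analysis.PDE.divFormStrongMaximumPrinciple`.

WHAT THIS IS NOT: not yet Harnack / the strong maximum principle; nothing NS-specific, no NS statement is touched.
-/

noncomputable section

open MeasureTheory Set Function Filter Topology Metric Module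
open scoped Matrix ENNReal NNReal

-- the summit and its single sub-problem share the name (CONVENTIONS §1), as in every Theorems file
set_option linter.dupNamespace false

namespace Summit.NavierStokesRegularity.NavierStokesRegularity.Theorems.PoloidalWindowDoorPoloidalWindowRigidityDivFormLocalMoser

open Summit.NavierStokesRegularity.NavierStokesRegularity.Theorems.PoloidalWindowDoorPoloidalWindowRigidityDivFormCaccioppoli
open Summit.NavierStokesRegularity.NavierStokesRegularity.Theorems.PoloidalWindowDoorPoloidalWindowRigidityDivFormReverseHolder
open Summit.NavierStokesRegularity.NavierStokesRegularity.Theorems.PoloidalWindowDoorPoloidalWindowRigidityDivFormMoserStep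
open Summit.NavierStokesRegularity.NavierStokesRegularity.Theorems.PoloidalWindowDoorPoloidalWindowRigidityDivFormLocalReverseHolder
open Literature.Analysis.FunctionSpaces

variable {n : ℕ} {a : EuclideanSpace ℝ (Fin n) → Matrix (Fin n) (Fin n) ℝ} {lam Λ : ℝ}
  {w : EuclideanSpace ℝ (Fin n) → ℝ} {U : Set (EuclideanSpace ℝ (Fin n))}

/-! ### The local reverse Hölder step -/

/-- **MOSER'S REVERSE HÖLDER STEP** (Moser 1961 §4; Gilbarg–Trudinger, proof of Thm 8.18), `n ≥ 3`, `κ = n/(n−2)`: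
for a `C¹` function `w ≥ 1` solving `div(a∇w) = 0` weakly against tests supported in `U ⊇ B̄(x₀,ρ)`, `σ = ±1`, `p > 0` with `σp ≠ 1`, `0 < ρ' < ρ`, and a cutoff constant `C₀`
as in `exists_closedBall_cutoff`,
`‖w^σ‖_{L^{pκ}(B̄(x₀,ρ'))} ≤ (C_S² · 2((q/(q−1))²nΛ+λ)/λ · (C₀/(ρ−ρ'))²)^{1/p} ‖w^σ‖_{L^p(B̄(x₀,ρ))}`, `q = σp`,
`C_S` = Mathlib's Sobolev constant `eLpNormLESNormFDerivOfEqInnerConst volume 2`. -/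
theorem moser_step_local (hn : 3 ≤ n) (hsymm : ∀ y, (a y).IsSymm) (hlam : 0 < lam)
    (hmeas : ∀ i j, Measurable fun y => a y i j)
    (hell : ∀ y (ξ : Fin n → ℝ), lam * (ξ ⬝ᵥ ξ) ≤ ξ ⬝ᵥ (a y *ᵥ ξ)) (hbd : ∀ y i j, |a y i j| ≤ Λ)
    (hw : ContDiff ℝ 1 w) (hw1 : ∀ y, 1 ≤ w y)
    (hweak : ∀ η : EuclideanSpace ℝ (Fin n) → ℝ, ContDiff ℝ 1 η → HasCompactSupport η → tsupport η ⊆ U →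
      ∫ y, ∑ i, ∑ j, a y i j * fderiv ℝ w y (EuclideanSpace.single i 1) *
        fderiv ℝ η y (EuclideanSpace.single j 1) = 0)
    {σ : ℝ} (hσ : σ = 1 ∨ σ = -1) {p : ℝ} (hp : 0 < p) (hq1 : σ * p ≠ 1)
    {C₀ : ℝ} (hcut : ∀ (x₀ : EuclideanSpace ℝ (Fin n)) (ρ' ρ : ℝ), 0 < ρ' → ρ' < ρ →
      ∃ χ : EuclideanSpace ℝ (Fin n) → ℝ, ContDiff ℝ 1 χ ∧ HasCompactSupport χ ∧ (∀ x, 0 ≤ χ x ∧ χ x ≤ 1) ∧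
        (∀ x ∈ closedBall x₀ ρ', χ x = 1) ∧ (∀ x, x ∉ ball x₀ ρ → χ x = 0) ∧ ∀ x, ‖fderiv ℝ χ x‖ ≤ C₀ / (ρ - ρ'))
    (x₀ : EuclideanSpace ℝ (Fin n)) {ρ' ρ : ℝ} (hρ' : 0 < ρ') (hρ : ρ' < ρ)
    (hU : closedBall x₀ ρ ⊆ U) :
    eLpNorm (fun y => w y ^ σ) (ENNReal.ofReal (p * (n / (n - 2 : ℝ)))) (volume.restrict (closedBall x₀ ρ')) ≤
      ENNReal.ofReal ((eLpNormLESNormFDerivOfEqInnerConst (volume : Measure (EuclideanSpace ℝ (Fin n))) 2 : ℝ) ^ 2 *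
          (2 * ((σ * p / (σ * p - 1)) ^ 2 * (n * Λ) + lam) / lam * (C₀ / (ρ - ρ')) ^ 2)) ^ (1 / p) *
        eLpNorm (fun y => w y ^ σ) (ENNReal.ofReal p) (volume.restrict (closedBall x₀ ρ)) := by
  -- notation and positivity
  set q : ℝ := σ * p with hq
  set κ : ℝ := n / (n - 2 : ℝ) with hκ
  set CS : ℝ≥0 := eLpNormLESNormFDerivOfEqInnerConst (volume : Measure (EuclideanSpace ℝ (Fin n))) 2 with hCS
  set M₀ : ℝ := 2 * ((q / (q - 1)) ^ 2 * (n * Λ) + lam) / lam * (C₀ / (ρ - ρ')) ^ 2 with hM₀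
  have hn2 : (0 : ℝ) < n - 2 := by
    have : (3 : ℝ) ≤ n := by exact_mod_cast hn
    linarith
  have hnpos : (0 : ℝ) < n := by linarith
  have hκpos : 0 < κ := by rw [hκ]; positivity
  have hpos : ∀ y, 0 < w y := fun y => lt_of_lt_of_le one_pos (hw1 y)
  have hq0 : q ≠ 0 := by
    rw [hq]; rcases hσ with h | h <;> simp [h, hp.ne']
  have hnΛ : 0 ≤ (n : ℝ) * Λ :=
    mul_nonneg (Nat.cast_nonneg n) ((abs_nonneg _).trans (hbd x₀ ⟨0, by omega⟩ ⟨0, by omega⟩))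
  have hM₀nn : 0 ≤ M₀ := by rw [hM₀]; positivity
  -- the cutoff and the test function
  obtain ⟨χ, hχ, hχc, hχ01, hχ1, hχ0, hχD⟩ := hcut x₀ ρ' ρ hρ' hρ
  have hχU : tsupport χ ⊆ U := by
    refine (closure_minimal (fun x hx => ?_) isClosed_closedBall).trans hU
    by_contra h
    exact hx (hχ0 x fun hb => h (ball_subset_closedBall hb))
  have hgC : ContDiff ℝ 1 fun y => w y ^ (q / 2) := contDiff_rpow_of_one_le hw hw1 (q / 2)
  have hφC : ContDiff ℝ 1 fun y => χ y * w y ^ (q / 2) := hχ.mul hgC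
  have hφc : HasCompactSupport fun y => χ y * w y ^ (q / 2) := hχc.mul_right (f' := fun y => w y ^ (q / 2))
  -- (E) energy: `λ ∫ ‖Dφ‖² ≤ λ M₀ ∫_{B̄ρ} w^q`
  have hE := energy_testPow_le_local hsymm hlam hmeas hell hbd hw hw1 hweak hq0 hq1 hχ hχc hχU hχ0 hχD (x₀ := x₀)
  have hY0 : 0 ≤ ∫ y in closedBall x₀ ρ, w y ^ q :=
    setIntegral_nonneg measurableSet_closedBall fun y _ => Real.rpow_nonneg (hpos y).le _
  have hE' : ∫ y, ‖fderiv ℝ (fun y => χ y * w y ^ (q / 2)) y‖ ^ 2 ≤ M₀ * ∫ y in closedBall x₀ ρ, w y ^ q := by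
    rw [← le_div_iff₀' hlam] at hE
    refine hE.trans (le_of_eq ?_)
    rw [hM₀]
    field_simp
  -- (S) Sobolev: `‖φ‖_{2κ} ≤ C_S ‖Dφ‖₂`
  have hfin : finrank ℝ (EuclideanSpace ℝ (Fin n)) = n := finrank_euclideanSpace_fin
  have hp'inv : ((Real.toNNReal (2 * κ) : ℝ≥0) : ℝ)⁻¹ = (2 : ℝ≥0)⁻¹ - (finrank ℝ (EuclideanSpace ℝ (Fin n)) : ℝ)⁻¹ := by
    rw [Real.coe_toNNReal _ (by positivity), hfin, hκ]
    push_cast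
    field_simp
  have hS := eLpNorm_le_eLpNorm_fderiv_of_eq_inner (μ := (volume : Measure (EuclideanSpace ℝ (Fin n)))) hφC hφc
    (p := 2) (p' := Real.toNNReal (2 * κ)) (by norm_num) (by rw [hfin]; omega) hp'inv
  -- (A) `‖Dφ‖₂ ≤ (M₀ · Z)^{1/2}`, `Z = ∫⁻_{B̄ρ} w^q`
  set Z : ℝ≥0∞ := ∫⁻ y in closedBall x₀ ρ, ENNReal.ofReal (w y ^ q) with hZ
  have hZeq : ENNReal.ofReal (∫ y in closedBall x₀ ρ, w y ^ q) = Z := by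
    rw [hZ, ofReal_integral_eq_lintegral_ofReal]
    · exact ((contDiff_rpow_of_one_le hw hw1 q).continuous.continuousOn.integrableOn_compact (isCompact_closedBall _ _))
    · exact Eventually.of_forall fun y => Real.rpow_nonneg (hpos y).le _
  have hA : eLpNorm (fderiv ℝ fun y => χ y * w y ^ (q / 2)) 2 volume ≤ (ENNReal.ofReal M₀ * Z) ^ (1 / 2 : ℝ) := by
    rw [eLpNorm_eq_lintegral_rpow_enorm_toReal two_ne_zero ENNReal.ofNat_ne_top, ENNReal.toReal_ofNat,
      lintegral_enorm_fderiv_sq hφC hφc]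
    refine ENNReal.rpow_le_rpow ?_ (by norm_num)
    rw [← hZeq, ← ENNReal.ofReal_mul hM₀nn]
    exact ENNReal.ofReal_le_ofReal hE'
  -- (B) `X^{1/(2κ)} ≤ ‖φ‖_{2κ}`, `X = ∫⁻_{B̄ρ'} w^{qκ}`
  set X : ℝ≥0∞ := ∫⁻ y in closedBall x₀ ρ', ENNReal.ofReal (w y ^ (q * κ)) with hX
  have hcoe : ((Real.toNNReal (2 * κ) : ℝ≥0) : ℝ≥0∞) = ENNReal.ofReal (2 * κ) := rfl
  have hB : X ^ (1 / (2 * κ)) ≤ eLpNorm (fun y => χ y * w y ^ (q / 2)) (Real.toNNReal (2 * κ)) volume := by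
    have hres : eLpNorm (fun y => χ y * w y ^ (q / 2)) (Real.toNNReal (2 * κ)) (volume.restrict (closedBall x₀ ρ')) ≤
        eLpNorm (fun y => χ y * w y ^ (q / 2)) (Real.toNNReal (2 * κ)) volume :=
      eLpNorm_mono_measure _ Measure.restrict_le_self
    refine le_trans (le_of_eq ?_) hres
    rw [hcoe, eLpNorm_eq_lintegral_rpow_enorm_toReal (ENNReal.ofReal_pos.2 (by positivity)).ne' ENNReal.ofReal_ne_top,
      ENNReal.toReal_ofReal (by positivity), hX]
    congr 1
    refine setLIntegral_congr_fun measurableSet_closedBall fun y hy => ?_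
    rw [hχ1 y hy, one_mul, Real.enorm_eq_ofReal (Real.rpow_nonneg (hpos y).le _),
      ENNReal.ofReal_rpow_of_nonneg (Real.rpow_nonneg (hpos y).le _) (by positivity), ← Real.rpow_mul (hpos y).le]
    congr 2
    ring
  -- (C) combine: `X^{1/(2κ)} ≤ C_S (M₀ Z)^{1/2}`
  have hC : X ^ (1 / (2 * κ)) ≤ (CS : ℝ≥0∞) * (ENNReal.ofReal M₀ * Z) ^ (1 / 2 : ℝ) :=
    hB.trans (hS.trans (mul_le_mul' le_rfl hA))
  -- (D) raise to the power `2/p` and identify the `eLpNorm`s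
  have hD := ENNReal.rpow_le_rpow hC (by positivity : (0 : ℝ) ≤ 2 / p)
  have hL : eLpNorm (fun y => w y ^ σ) (ENNReal.ofReal (p * κ)) (volume.restrict (closedBall x₀ ρ')) =
      (X ^ (1 / (2 * κ))) ^ (2 / p) := by
    rw [eLpNorm_rpow_eq _ hpos σ (by positivity : 0 < p * κ), ← ENNReal.rpow_mul, hX]
    have h1 : σ * (p * κ) = q * κ := by rw [hq]; ring
    have h2 : 1 / (p * κ) = 1 / (2 * κ) * (2 / p) := by field_simp
    rw [h1, h2]
  have hR : eLpNorm (fun y => w y ^ σ) (ENNReal.ofReal p) (volume.restrict (closedBall x₀ ρ)) = Z ^ (1 / p) := by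
    rw [eLpNorm_rpow_eq _ hpos σ hp, hZ]
  have hCS2 : ENNReal.ofReal ((CS : ℝ) ^ 2 * M₀) = (CS : ℝ≥0∞) ^ 2 * ENNReal.ofReal M₀ := by
    rw [ENNReal.ofReal_mul (sq_nonneg _), ENNReal.ofReal_pow (NNReal.coe_nonneg _), ENNReal.ofReal_coe_nnreal]
  have key : ∀ m z : ℝ≥0∞, ((CS : ℝ≥0∞) * (m * z) ^ (1 / 2 : ℝ)) ^ (2 / p) =
      ((CS : ℝ≥0∞) ^ 2 * m) ^ (1 / p) * z ^ (1 / p) := by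
    intro m z
    rw [ENNReal.mul_rpow_of_nonneg _ _ (by positivity : (0 : ℝ) ≤ 2 / p), ← ENNReal.rpow_mul,
      show (1 / 2 : ℝ) * (2 / p) = 1 / p by field_simp,
      ENNReal.mul_rpow_of_nonneg m z (by positivity : (0 : ℝ) ≤ 1 / p),
      ENNReal.mul_rpow_of_nonneg _ m (by positivity : (0 : ℝ) ≤ 1 / p), ← mul_assoc]
    congr 2
    rw [← ENNReal.rpow_natCast, ← ENNReal.rpow_mul]
    congr 1
    push_cast
    field_simp
  rw [hL, hR, hCS2, ← key]
  exact hD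

/-! ### The Moser chain between two concentric balls -/

/-- **MOSER ITERATION, local boundedness of `w^σ`** (Moser 1961 §4; Gilbarg–Trudinger Thm 8.18, proof), `n ≥ 3`,
`κ = n/(n−2)`, LOCAL form with two free radii: for a `C¹` function `w ≥ 1` solving `div(a∇w) = 0` weakly against tests
supported in `U ⊇ B̄(x₀,r)`, `σ = ±1`, `p₀ > 0` such that along the chain `p_k = p₀κ^k` no `σp_k` equals `1` and
`(σp_k/(σp_k−1))² ≤ D`, and radii `0 < r' < r`:
`‖w^σ‖_{L^∞(B̄(x₀,r'))} ≤ (K/(r−r')²)^{κ/(p₀(κ−1))} 4^{κ/(p₀(κ−1)²)} ‖w^σ‖_{L^{p₀}(B̄(x₀,r))}`,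
`K = max(C_S,1)² · 2(DnΛ + λ)/λ · 4C₀²` (`C_S` Mathlib's Sobolev constant, `C₀` the cutoff constant). -/
theorem moser_chain_local (hn : 3 ≤ n) (hsymm : ∀ y, (a y).IsSymm) (hlam : 0 < lam)
    (hmeas : ∀ i j, Measurable fun y => a y i j)
    (hell : ∀ y (ξ : Fin n → ℝ), lam * (ξ ⬝ᵥ ξ) ≤ ξ ⬝ᵥ (a y *ᵥ ξ)) (hbd : ∀ y i j, |a y i j| ≤ Λ)
    (hw : ContDiff ℝ 1 w) (hw1 : ∀ y, 1 ≤ w y)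
    (hweak : ∀ η : EuclideanSpace ℝ (Fin n) → ℝ, ContDiff ℝ 1 η → HasCompactSupport η → tsupport η ⊆ U →
      ∫ y, ∑ i, ∑ j, a y i j * fderiv ℝ w y (EuclideanSpace.single i 1) *
        fderiv ℝ η y (EuclideanSpace.single j 1) = 0)
    {σ : ℝ} (hσ : σ = 1 ∨ σ = -1) {p₀ : ℝ} (hp₀ : 0 < p₀) {D : ℝ} (hD0 : 0 ≤ D)
    (hne : ∀ k : ℕ, σ * (p₀ * (n / (n - 2 : ℝ)) ^ k) ≠ 1)
    (hD : ∀ k : ℕ, (σ * (p₀ * (n / (n - 2 : ℝ)) ^ k) / (σ * (p₀ * (n / (n - 2 : ℝ)) ^ k) - 1)) ^ 2 ≤ D)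
    {C₀ : ℝ} (hC₀ : 0 < C₀) (hcut : ∀ (x₀ : EuclideanSpace ℝ (Fin n)) (ρ' ρ : ℝ), 0 < ρ' → ρ' < ρ →
      ∃ χ : EuclideanSpace ℝ (Fin n) → ℝ, ContDiff ℝ 1 χ ∧ HasCompactSupport χ ∧ (∀ x, 0 ≤ χ x ∧ χ x ≤ 1) ∧
        (∀ x ∈ closedBall x₀ ρ', χ x = 1) ∧ (∀ x, x ∉ ball x₀ ρ → χ x = 0) ∧ ∀ x, ‖fderiv ℝ χ x‖ ≤ C₀ / (ρ - ρ'))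
    (x₀ : EuclideanSpace ℝ (Fin n)) {r' r : ℝ} (hr' : 0 < r') (hr'r : r' < r) (hU : closedBall x₀ r ⊆ U) :
    eLpNorm (fun y => w y ^ σ) ∞ (volume.restrict (closedBall x₀ r')) ≤
      ENNReal.ofReal ((max (eLpNormLESNormFDerivOfEqInnerConst (volume : Measure (EuclideanSpace ℝ (Fin n))) 2 : ℝ) 1) ^ 2
            * (2 * (D * (n * Λ) + lam) / lam * (4 * C₀ ^ 2)) / (r - r') ^ 2) ^
          ((n / (n - 2 : ℝ)) / (p₀ * ((n / (n - 2 : ℝ)) - 1))) *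
        (4 : ℝ≥0∞) ^ ((n / (n - 2 : ℝ)) / (p₀ * ((n / (n - 2 : ℝ)) - 1) ^ 2)) *
        eLpNorm (fun y => w y ^ σ) (ENNReal.ofReal p₀) (volume.restrict (closedBall x₀ r)) := by
  -- notation
  set κ : ℝ := n / (n - 2 : ℝ) with hκ
  set CS : ℝ≥0 := eLpNormLESNormFDerivOfEqInnerConst (volume : Measure (EuclideanSpace ℝ (Fin n))) 2 with hCS
  set K : ℝ := (max (CS : ℝ) 1) ^ 2 * (2 * (D * (n * Λ) + lam) / lam * (4 * C₀ ^ 2)) with hK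
  have hn2 : (0 : ℝ) < n - 2 := by
    have : (3 : ℝ) ≤ n := by exact_mod_cast hn
    linarith
  have hκ1 : 1 < κ := by
    rw [hκ, lt_div_iff₀ hn2]; linarith
  have hκ0 : 0 < κ := zero_lt_one.trans hκ1
  have hpos : ∀ y, 0 < w y := fun y => lt_of_lt_of_le one_pos (hw1 y)
  have hnΛ : 0 ≤ (n : ℝ) * Λ :=
    mul_nonneg (Nat.cast_nonneg n) ((abs_nonneg _).trans (hbd x₀ ⟨0, by omega⟩ ⟨0, by omega⟩))
  have hmax : (1 : ℝ) ≤ max (CS : ℝ) 1 := le_max_right _ _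
  have hKpos : 0 < K := by rw [hK]; positivity
  -- radii and sets
  have hδ : 0 < r - r' := sub_pos.2 hr'r
  set ρ : ℕ → ℝ := fun k => r' + (r - r') * (2 : ℝ)⁻¹ ^ k with hρ
  set A : ℕ → Set (EuclideanSpace ℝ (Fin n)) := fun k => closedBall x₀ (ρ k) with hA
  have hrpos : ∀ k, 0 < ρ k := fun k => by positivity
  have hrdiff : ∀ k, ρ k - ρ (k + 1) = (r - r') * (2 : ℝ)⁻¹ ^ (k + 1) := fun k => by
    simp only [hρ, pow_succ]; ring
  have hrlt : ∀ k, ρ (k + 1) < ρ k := fun k => by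
    have h := hrdiff k
    have : (0 : ℝ) < (r - r') * (2 : ℝ)⁻¹ ^ (k + 1) := by positivity
    linarith
  have hρle : ∀ k, ρ k ≤ r := fun k => by
    have h1 : (2 : ℝ)⁻¹ ^ k ≤ 1 := pow_le_one₀ (by norm_num) (by norm_num)
    have h2 : (r - r') * (2 : ℝ)⁻¹ ^ k ≤ (r - r') * 1 := mul_le_mul_of_nonneg_left h1 hδ.le
    simp only [hρ]; linarith
  -- the chain constants
  set Cch : ℝ≥0 := Real.toNNReal (K / (r - r') ^ 2) with hCch
  have hCch0 : Cch ≠ 0 := by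
    rw [hCch]; exact (Real.toNNReal_pos.2 (by positivity)).ne'
  have hb : (4 : ℝ≥0) ≠ 0 := by norm_num
  have hcoeC : ((Cch : ℝ≥0) : ℝ≥0∞) = ENNReal.ofReal (K / (r - r') ^ 2) := rfl
  have hcoe4 : ((4 : ℝ≥0) : ℝ≥0∞) = 4 := by norm_num
  -- the reverse Hölder chain
  have H : ∀ k : ℕ, eLpNorm (fun y => w y ^ σ) (ENNReal.ofReal (p₀ * κ ^ (k + 1))) (volume.restrict (A (k + 1))) ≤
      (((Cch : ℝ≥0) : ℝ≥0∞) * ((4 : ℝ≥0) : ℝ≥0∞) ^ k) ^ (1 / (p₀ * κ ^ k)) *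
        eLpNorm (fun y => w y ^ σ) (ENNReal.ofReal (p₀ * κ ^ k)) (volume.restrict (A k)) := by
    intro k
    have hpk : 0 < p₀ * κ ^ k := by positivity
    have hstep := moser_step_local hn hsymm hlam hmeas hell hbd hw hw1 hweak hσ hpk (hne k) hcut x₀ (hrpos (k + 1)) (hrlt k)
      ((closedBall_subset_closedBall (hρle k)).trans hU)
    rw [pow_succ, ← mul_assoc]
    refine hstep.trans (mul_le_mul' (ENNReal.rpow_le_rpow ?_ (by positivity)) le_rfl)
    -- the step constant is at most `Cch · 4^k`
    rw [hcoeC, hcoe4, show (4 : ℝ≥0∞) ^ k = ENNReal.ofReal (4 ^ k) by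
      rw [ENNReal.ofReal_pow (by norm_num : (0:ℝ) ≤ 4)]; norm_num, ← ENNReal.ofReal_mul (by positivity)]
    refine ENNReal.ofReal_le_ofReal ?_
    set q : ℝ := σ * (p₀ * κ ^ k) with hq
    have h1 : (q / (q - 1)) ^ 2 * (n * Λ) ≤ D * (n * Λ) := mul_le_mul_of_nonneg_right (hD k) hnΛ
    have h2 : (C₀ / (ρ k - ρ (k + 1))) ^ 2 = 4 * C₀ ^ 2 * 4 ^ k / (r - r') ^ 2 := by
      rw [hrdiff, inv_pow, show (4 : ℝ) ^ k = (2 ^ k) ^ 2 by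
        rw [show (4 : ℝ) = 2 ^ 2 by norm_num, ← pow_mul, ← pow_mul, mul_comm]]
      field_simp
      ring
    have h3 : (CS : ℝ) ^ 2 ≤ (max (CS : ℝ) 1) ^ 2 := pow_le_pow_left₀ (NNReal.coe_nonneg _) (le_max_left _ _) 2
    have h4 : 2 * ((q / (q - 1)) ^ 2 * (n * Λ) + lam) / lam ≤ 2 * (D * (n * Λ) + lam) / lam := by
      refine div_le_div_of_nonneg_right ?_ hlam.le
      linarith
    have h4' : 0 ≤ 2 * ((q / (q - 1)) ^ 2 * (n * Λ) + lam) / lam := by positivity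
    calc (CS : ℝ) ^ 2 * (2 * ((q / (q - 1)) ^ 2 * (n * Λ) + lam) / lam * (C₀ / (ρ k - ρ (k + 1))) ^ 2)
        = (CS : ℝ) ^ 2 * (2 * ((q / (q - 1)) ^ 2 * (n * Λ) + lam) / lam) * (4 * C₀ ^ 2 * 4 ^ k / (r - r') ^ 2) := by
          rw [h2]; ring
      _ ≤ (max (CS : ℝ) 1) ^ 2 * (2 * (D * (n * Λ) + lam) / lam) * (4 * C₀ ^ 2 * 4 ^ k / (r - r') ^ 2) := by
          have h5 : 0 ≤ 4 * C₀ ^ 2 * 4 ^ k / (r - r') ^ 2 := by positivity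
          exact mul_le_mul_of_nonneg_right (mul_le_mul h3 h4 h4' (by positivity)) h5
      _ = K / (r - r') ^ 2 * 4 ^ k := by rw [hK]; ring
  -- Moser's iteration lemma
  have hf : AEStronglyMeasurable (fun y => w y ^ σ) (volume : Measure (EuclideanSpace ℝ (Fin n))) :=
    (contDiff_rpow_of_one_le hw hw1 σ).continuous.aestronglyMeasurable
  have hchain := eLpNorm_top_le_of_moser_chain (μ := (volume : Measure (EuclideanSpace ℝ (Fin n)))) hf
    (A := A) hp₀ hκ1 hCch0 hb H
  -- `B̄(x₀,r') ⊆ ⋂ A_k` and `A 0 = B̄(x₀,r)`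
  have hsub : closedBall x₀ r' ⊆ ⋂ k, A k := by
    refine subset_iInter fun k => closedBall_subset_closedBall ?_
    have : (0 : ℝ) ≤ (r - r') * (2 : ℝ)⁻¹ ^ k := by positivity
    simp only [hρ]; linarith
  have hA0 : A 0 = closedBall x₀ r := by
    simp only [hA, hρ, pow_zero]; ring_nf
  calc eLpNorm (fun y => w y ^ σ) ∞ (volume.restrict (closedBall x₀ r'))
      ≤ eLpNorm (fun y => w y ^ σ) ∞ (volume.restrict (⋂ k, A k)) :=
        eLpNorm_mono_measure _ (Measure.restrict_mono hsub le_rfl)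
    _ ≤ ((Cch : ℝ≥0) : ℝ≥0∞) ^ (κ / (p₀ * (κ - 1))) * ((4 : ℝ≥0) : ℝ≥0∞) ^ (κ / (p₀ * (κ - 1) ^ 2)) *
          eLpNorm (fun y => w y ^ σ) (ENNReal.ofReal p₀) (volume.restrict (A 0)) := hchain
    _ = ENNReal.ofReal (K / (r - r') ^ 2) ^ (κ / (p₀ * (κ - 1))) * (4 : ℝ≥0∞) ^ (κ / (p₀ * (κ - 1) ^ 2)) *
          eLpNorm (fun y => w y ^ σ) (ENNReal.ofReal p₀) (volume.restrict (closedBall x₀ r)) := by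
        rw [hcoeC, hcoe4, hA0]

end Summit.NavierStokesRegularity.NavierStokesRegularity.Theorems.PoloidalWindowDoorPoloidalWindowRigidityDivFormLocalMoser

end
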